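import Summits.SmoothPoincare4.SmoothPoincare4.Theorems.ConvexBisectionAcyclicBisectionExistsStabilisationData
import HarnessLib

/-!
# N3 (`stub_STgeo`) ▸ N3-nat ▸ piece N3d-4/5/6 `node_trade`: THE CONTRACT — trading + local re-dig (T1),
# re-spacing the duals (T2), finish (T3), kernel-checked; and the block letters of the natural word
(wave 8, brick J7-5 of stub `stub_STgeo` = node N3 of NF4, line `modp-braid-orbits`, crux
`ConvexBisection.AcyclicBisectionExists`, item stmt-SmoothPoincare4-10508; registered sub-goal
`helper_natWord_get_lt_four`; design file `work/design/N3d_Pieces_Design.lean` (J7, wave 8) §D; the piece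
text is the hypothesis `h4` of `StabilisationData.node_STnat_of_pieces` (`…StabilisationAngles.lean`, H6).)

Piece N3d-4/5/6 (`TwoSidedStabModel M g l S → ModelsOnFibred M (g+1) (natWord g c l)`) is cut into
* (T1) `piece4_tradeRedig` (`work/stubs/sig_piece4_tradeRedig.txt`): trade the two cap-side handles into `X₁`
  (an INSTANTIATION of T3's generic machinery with the roles `X := W₂`, `W := X₁`: V5
  `exists_standardForm`, Y6 `exists_complementPiece`, X1 `exists_dualAttachmentData` are generic in the
  second piece) and RE-DIG the duals — which land on `X₁`'s own block belt circles by the matching clause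
  (iii) — as Lefschetz handles `(A*, +1)`, `(B*, +1)` of shadows `a`, `b` at the clockwise-nearby directions
  `pageDir (n+4) 0 · e^{−iη_A}`, `pageDir (n+4) 2 · e^{−iη_B}` (design finding F-J7-5: separating two cores
  in one page is not a fibred move, the separation happens inside the local re-dig); output: a dualised
  fibred datum of `M` over `Base (g+1)` indexed by `Fin 4 ⊕ Fin n`;
* (T2) `piece4_respaceDuals` (`sig_piece4_respaceDuals.txt`): exactly fibred sector rotations carry the duals
  to the positions `1`, `3` (after re-fixing the gauge near the binding at genus `g+1`);
* (T3) `piece4_finish` (`sig_piece4_finish.txt`): re-indexing `Fin 4 ⊕ Fin n ≃ Fin (n+4)`,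
  `IsLefschetzLink (g+1) (natWord g c l)`, `modelsOnFibred_of_data` — for which `natWord_get_lt_four`,
  `natWord_twist_lt_four` give the block letters in `Fin 4`-vector form.
`node_trade_of_subpieces` is the pure chaining.  No definitions.
References: R. İ. Baykur, AGT 6 (2006), Lemma 1, §5 p. 13 [Baykur2006]; J. B. Etnyre, T. Fuller, IMRN
2006, §2 [EtnyreFuller2006].
-/

noncomputable section

-- the prescribed namespace `Summit.<P>.<Sub>.…` duplicates `SmoothPoincare4` (P = Sub)
set_option linter.dupNamespace false

open scoped Manifold ContDiff Topology Real
open Set Function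

namespace Summit.SmoothPoincare4.SmoothPoincare4.Theorems.AcyclicBisectionExists.ModpBraidOrbits

open Literature.GroupTheory.CombinatorialGroupTheory.SignedHurwitz
open Literature.Topology.FourManifolds Literature.Topology.FourManifolds.LefschetzBase
open Literature.Topology.FourManifolds.HandleAttachingMap
open Literature.Geometry.Symplectic

namespace StabTradeContract

/-! ## §1 The block letters of the natural word -/

/-- **The four block letters of the natural word** `natWord g c l = (a,+)(a,−)(b,+)(b,−) ++ embed l`, in the
`Fin 4`-vector form consumed by the finish sub-piece (T3) of N3d-4/5/6 (`a = newE g + embed g c`,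
`b = newF g`). [folklore] -/
theorem natWord_get_lt_four {g : ℕ} (c : Fin g ⊕ Fin g → ℤ) (l : IntWord g) (i : Fin 4)
    (hi : (i : ℕ) < (natWord g c l).length) :
    (natWord g c l).get ⟨i, hi⟩ =
      (![newE g + embed g c, newE g + embed g c, newF g, newF g] i, ![true, false, true, false] i) := by
  fin_cases i <;> rfl

/-- The page-twisting signs of the four block letters: `−1, +1, −1, +1`. [folklore] -/
theorem natWord_twist_lt_four (i : Fin 4) :
    (if ![true, false, true, false] i then (-1 : ℤ) else 1) = ![(-1 : ℤ), 1, -1, 1] i := by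
  fin_cases i <;> rfl

/-! ## §2 The contract -/

/-- **CONTRACT N3d-4/5/6: `node_trade` (text of `work/stubs/sig_node_trade.txt`) from (T1), (T2), (T3)**
— PROVED (pure chaining). [cite: Baykur2006, §5 p. 13] -/
theorem node_trade_of_subpieces
    (hT1 : ∀ (M : Type) [TopologicalSpace M] [T2Space M] [SecondCountableTopology M]
        [ChartedSpace (EuclideanSpace ℝ (Fin 4)) M] [IsManifold (𝓡 4) ∞ M] (g : ℕ) (l : IntWord g)
        (c : Fin g ⊕ Fin g → ℤ) (S : StabBaseData g l.length c),
        TwoSidedStabModel M g l S →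
        ∃ (ηA ηB : ℝ), 0 < ηA ∧ ηA < 4 * π / ((l.length + 4 : ℕ) : ℝ) ∧ 0 < ηB ∧
          ηB < 4 * π / ((l.length + 4 : ℕ) : ℝ) ∧
        ∃ (X'' : Type) (_ : TopologicalSpace X'') (_ : T2Space X'') (_ : SecondCountableTopology X'')
          (_ : CompactSpace X'') (_ : ChartedSpace (EuclideanHalfSpace 4) X'') (_ : IsManifold (𝓡∂ 4) ∞ X'')
          (h'' : Fin 4 ⊕ Fin l.length → HandleAttachingMap 3 2 (Base (g + 1)))
          (D'' : MultiAttachmentData h'' (𝓡∂ 4) X'') (bX'' : BoundaryData (𝓡∂ 4) X'' (𝓡 3))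
          (Ψ'' : bX''.carrier ≃ₘ⟮𝓡 3, 𝓡 3⟯ (bBase (g + 1)).carrier),
          (∀ (i : Fin 4) θ, (h'' (Sum.inl i)).attachingCircle θ ∈ page (g + 1) (![pageDir (l.length + 4) 0,
            pageDir (l.length + 4) 0 * Complex.exp (((-ηA : ℝ) : ℂ) * Complex.I), pageDir (l.length + 4) 2,
            pageDir (l.length + 4) 2 * Complex.exp (((-ηB : ℝ) : ℂ) * Complex.I)] i)) ∧
          (∀ (k : Fin l.length) θ, (h'' (Sum.inr k)).attachingCircle θ ∈
            page (g + 1) (pageDir (l.length + 4) (k + 4))) ∧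
          (∀ i, shadow (g + 1) (h'' (Sum.inl i)).attachingCircle (h'' (Sum.inl i)).continuous_attachingCircle =
            ![newE g + embed g c, newE g + embed g c, newF g, newF g] i) ∧
          (∀ k, shadow (g + 1) (h'' (Sum.inr k)).attachingCircle (h'' (Sum.inr k)).continuous_attachingCircle =
            embed g (l.get k).1) ∧
          (∀ i, pageTwisting (g + 1) (h'' (Sum.inl i)).attachingCircle (h'' (Sum.inl i)).attachingFraming =
            ![(-1 : ℤ), 1, -1, 1] i) ∧
          (∀ k, pageTwisting (g + 1) (h'' (Sum.inr k)).attachingCircle (h'' (Sum.inr k)).attachingFraming =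
            if (l.get k).2 then -1 else 1) ∧
          IsBoundaryGluing bX'' (bBase (g + 1)) Ψ'' (𝓡 4) M ∧
          (∀ (y : bX''.carrier) (a : ↥(coresComplement h'')), bX''.incl y = D''.jA a →
            ∃ r : ℝ, 0 < r ∧ w (g + 1) ((bBase (g + 1)).incl (Ψ'' y)).1 = (r : ℂ) * w (g + 1) (a : Base (g + 1)).1))
    (hT2 : ∀ (M : Type) [TopologicalSpace M] [T2Space M] [SecondCountableTopology M]
        [ChartedSpace (EuclideanSpace ℝ (Fin 4)) M] [IsManifold (𝓡 4) ∞ M] (g : ℕ) (l : IntWord g)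
        (c : Fin g ⊕ Fin g → ℤ) (S : StabBaseData g l.length c) (ηA ηB : ℝ),
        0 < ηA → ηA < 4 * π / ((l.length + 4 : ℕ) : ℝ) → 0 < ηB → ηB < 4 * π / ((l.length + 4 : ℕ) : ℝ) →
        (∃ (X'' : Type) (_ : TopologicalSpace X'') (_ : T2Space X'') (_ : SecondCountableTopology X'')
          (_ : CompactSpace X'') (_ : ChartedSpace (EuclideanHalfSpace 4) X'') (_ : IsManifold (𝓡∂ 4) ∞ X'')
          (h'' : Fin 4 ⊕ Fin l.length → HandleAttachingMap 3 2 (Base (g + 1)))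
          (D'' : MultiAttachmentData h'' (𝓡∂ 4) X'') (bX'' : BoundaryData (𝓡∂ 4) X'' (𝓡 3))
          (Ψ'' : bX''.carrier ≃ₘ⟮𝓡 3, 𝓡 3⟯ (bBase (g + 1)).carrier),
          (∀ (i : Fin 4) θ, (h'' (Sum.inl i)).attachingCircle θ ∈ page (g + 1) (![pageDir (l.length + 4) 0,
            pageDir (l.length + 4) 0 * Complex.exp (((-ηA : ℝ) : ℂ) * Complex.I), pageDir (l.length + 4) 2,
            pageDir (l.length + 4) 2 * Complex.exp (((-ηB : ℝ) : ℂ) * Complex.I)] i)) ∧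
          (∀ (k : Fin l.length) θ, (h'' (Sum.inr k)).attachingCircle θ ∈
            page (g + 1) (pageDir (l.length + 4) (k + 4))) ∧
          (∀ i, shadow (g + 1) (h'' (Sum.inl i)).attachingCircle (h'' (Sum.inl i)).continuous_attachingCircle =
            ![newE g + embed g c, newE g + embed g c, newF g, newF g] i) ∧
          (∀ k, shadow (g + 1) (h'' (Sum.inr k)).attachingCircle (h'' (Sum.inr k)).continuous_attachingCircle =
            embed g (l.get k).1) ∧
          (∀ i, pageTwisting (g + 1) (h'' (Sum.inl i)).attachingCircle (h'' (Sum.inl i)).attachingFraming =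
            ![(-1 : ℤ), 1, -1, 1] i) ∧
          (∀ k, pageTwisting (g + 1) (h'' (Sum.inr k)).attachingCircle (h'' (Sum.inr k)).attachingFraming =
            if (l.get k).2 then -1 else 1) ∧
          IsBoundaryGluing bX'' (bBase (g + 1)) Ψ'' (𝓡 4) M ∧
          (∀ (y : bX''.carrier) (a : ↥(coresComplement h'')), bX''.incl y = D''.jA a →
            ∃ r : ℝ, 0 < r ∧ w (g + 1) ((bBase (g + 1)).incl (Ψ'' y)).1 = (r : ℂ) * w (g + 1) (a : Base (g + 1)).1)) →
        ∃ (X'' : Type) (_ : TopologicalSpace X'') (_ : T2Space X'') (_ : SecondCountableTopology X'')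
          (_ : CompactSpace X'') (_ : ChartedSpace (EuclideanHalfSpace 4) X'') (_ : IsManifold (𝓡∂ 4) ∞ X'')
          (h'' : Fin 4 ⊕ Fin l.length → HandleAttachingMap 3 2 (Base (g + 1)))
          (D'' : MultiAttachmentData h'' (𝓡∂ 4) X'') (bX'' : BoundaryData (𝓡∂ 4) X'' (𝓡 3))
          (Ψ'' : bX''.carrier ≃ₘ⟮𝓡 3, 𝓡 3⟯ (bBase (g + 1)).carrier),
          (∀ (i : Fin 4) θ, (h'' (Sum.inl i)).attachingCircle θ ∈ page (g + 1) (pageDir (l.length + 4) i)) ∧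
          (∀ (k : Fin l.length) θ, (h'' (Sum.inr k)).attachingCircle θ ∈
            page (g + 1) (pageDir (l.length + 4) (k + 4))) ∧
          (∀ i, shadow (g + 1) (h'' (Sum.inl i)).attachingCircle (h'' (Sum.inl i)).continuous_attachingCircle =
            ![newE g + embed g c, newE g + embed g c, newF g, newF g] i) ∧
          (∀ k, shadow (g + 1) (h'' (Sum.inr k)).attachingCircle (h'' (Sum.inr k)).continuous_attachingCircle =
            embed g (l.get k).1) ∧
          (∀ i, pageTwisting (g + 1) (h'' (Sum.inl i)).attachingCircle (h'' (Sum.inl i)).attachingFraming =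
            ![(-1 : ℤ), 1, -1, 1] i) ∧
          (∀ k, pageTwisting (g + 1) (h'' (Sum.inr k)).attachingCircle (h'' (Sum.inr k)).attachingFraming =
            if (l.get k).2 then -1 else 1) ∧
          IsBoundaryGluing bX'' (bBase (g + 1)) Ψ'' (𝓡 4) M ∧
          (∀ (y : bX''.carrier) (a : ↥(coresComplement h'')), bX''.incl y = D''.jA a →
            ∃ r : ℝ, 0 < r ∧ w (g + 1) ((bBase (g + 1)).incl (Ψ'' y)).1 = (r : ℂ) * w (g + 1) (a : Base (g + 1)).1))
    (hT3 : ∀ (M : Type) [TopologicalSpace M] [T2Space M] [SecondCountableTopology M]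
        [ChartedSpace (EuclideanSpace ℝ (Fin 4)) M] [IsManifold (𝓡 4) ∞ M] (g : ℕ) (l : IntWord g)
        (c : Fin g ⊕ Fin g → ℤ) (S : StabBaseData g l.length c),
        (∃ (X'' : Type) (_ : TopologicalSpace X'') (_ : T2Space X'') (_ : SecondCountableTopology X'')
          (_ : CompactSpace X'') (_ : ChartedSpace (EuclideanHalfSpace 4) X'') (_ : IsManifold (𝓡∂ 4) ∞ X'')
          (h'' : Fin 4 ⊕ Fin l.length → HandleAttachingMap 3 2 (Base (g + 1)))
          (D'' : MultiAttachmentData h'' (𝓡∂ 4) X'') (bX'' : BoundaryData (𝓡∂ 4) X'' (𝓡 3))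
          (Ψ'' : bX''.carrier ≃ₘ⟮𝓡 3, 𝓡 3⟯ (bBase (g + 1)).carrier),
          (∀ (i : Fin 4) θ, (h'' (Sum.inl i)).attachingCircle θ ∈ page (g + 1) (pageDir (l.length + 4) i)) ∧
          (∀ (k : Fin l.length) θ, (h'' (Sum.inr k)).attachingCircle θ ∈
            page (g + 1) (pageDir (l.length + 4) (k + 4))) ∧
          (∀ i, shadow (g + 1) (h'' (Sum.inl i)).attachingCircle (h'' (Sum.inl i)).continuous_attachingCircle =
            ![newE g + embed g c, newE g + embed g c, newF g, newF g] i) ∧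
          (∀ k, shadow (g + 1) (h'' (Sum.inr k)).attachingCircle (h'' (Sum.inr k)).continuous_attachingCircle =
            embed g (l.get k).1) ∧
          (∀ i, pageTwisting (g + 1) (h'' (Sum.inl i)).attachingCircle (h'' (Sum.inl i)).attachingFraming =
            ![(-1 : ℤ), 1, -1, 1] i) ∧
          (∀ k, pageTwisting (g + 1) (h'' (Sum.inr k)).attachingCircle (h'' (Sum.inr k)).attachingFraming =
            if (l.get k).2 then -1 else 1) ∧
          IsBoundaryGluing bX'' (bBase (g + 1)) Ψ'' (𝓡 4) M ∧
          (∀ (y : bX''.carrier) (a : ↥(coresComplement h'')), bX''.incl y = D''.jA a →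
            ∃ r : ℝ, 0 < r ∧ w (g + 1) ((bBase (g + 1)).incl (Ψ'' y)).1 = (r : ℂ) * w (g + 1) (a : Base (g + 1)).1)) →
        ModelsOnFibred M (g + 1) (natWord g c l)) :
    ∀ (M : Type) [TopologicalSpace M] [T2Space M] [SecondCountableTopology M]
      [ChartedSpace (EuclideanSpace ℝ (Fin 4)) M] [IsManifold (𝓡 4) ∞ M] (g : ℕ) (l : IntWord g)
      (c : Fin g ⊕ Fin g → ℤ) (S : StabBaseData g l.length c),
      TwoSidedStabModel M g l S → ModelsOnFibred M (g + 1) (natWord g c l) := by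
  intro M _ _ _ _ _ g l c S hTS
  obtain ⟨ηA, ηB, hA0, hA1, hB0, hB1, hdual⟩ := hT1 M g l c S hTS
  exact hT3 M g l c S (hT2 M g l c S ηA ηB hA0 hA1 hB0 hB1 hdual)

end StabTradeContract

/-! ## Registered helper -/

/-- **Registered helper `helper_natWord_get_lt_four` (sub-goal of `stub_STgeo` ▸ N3-nat ▸ N3d-6, wave 8, lead
c5): the four block letters of `natWord g c l` in `Fin 4`-vector form; the file carries the contract
`StabTradeContract.node_trade_of_subpieces`.** [folklore] -/
theorem helper_natWord_get_lt_four : ∀ (g : ℕ) (c : Fin g ⊕ Fin g → ℤ) (l : Literature.GroupTheory.CombinatorialGroupTheory.SignedHurwitz.IntWord g) (i : Fin 4) (hi : (i : ℕ) < (Summit.SmoothPoincare4.SmoothPoincare4.Theorems.AcyclicBisectionExists.ModpBraidOrbits.natWord g c l).length), (Summit.SmoothPoincare4.SmoothPoincare4.Theorems.AcyclicBisectionExists.ModpBraidOrbits.natWord g c l).get ⟨i, hi⟩ = (![Literature.GroupTheory.CombinatorialGroupTheory.SignedHurwitz.newE g + Literature.GroupTheory.CombinatorialGroupTheory.SignedHurwitz.embed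 g c, Literature.GroupTheory.CombinatorialGroupTheory.SignedHurwitz.newE g + Literature.GroupTheory.CombinatorialGroupTheory.SignedHurwitz.embed g c, Literature.GroupTheory.CombinatorialGroupTheory.SignedHurwitz.newF g, Literature.GroupTheory.CombinatorialGroupTheory.SignedHurwitz.newF g] i, ![true, false, true, false] i) :=
  fun _ c l i hi => StabTradeContract.natWord_get_lt_four c l i hi

end Summit.SmoothPoincare4.SmoothPoincare4.Theorems.AcyclicBisectionExists.ModpBraidOrbits

end
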